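import Summits.CriticalPhenomena.PercolationContinuityZ3.Theorems.PercNearOneGluingNoHeavyLowerTailSahiOneStepGoodPivot
import Summits.CriticalPhenomena.PercolationContinuityZ3.Theorems.PercNearOneGluingNoHeavyLowerTailSahiOneStepCone
import HarnessLib

/-!
# One-step scheme: `(2′)` on a SECTION-CLOSED CLASS of partners from good pivots inside the class

Support file (prover prim-ineq-prove-3 gen 37; `--supports stmt-CriticalPhenomena-4575`; memo
`run/shared/lean/prim/prim-ineq-prove-3/PROOF-G37-VERTEX-COVER-PARTNERS.md` §1).  No definitions, no named facts, no sorries.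

Gen 27's reduction `osN_threshold_nonneg_of_goodPivots` asks for a good pivot for EVERY increasing event `B` — a hypothesis refuted in
general (gen 28, fat-link events).  The induction, however, only ever visits the two sections `{ω | insert e ω ∈ B}`, `{ω | ω \ {e} ∈ B}`
of the current partner.  This file records the CLASS form actually needed by the 2-CNF / vertex-cover theorem of the memo:

* `osN_threshold_nonneg_of_goodPivots_on` — let `𝒞 F B` be any predicate on (block, event) closed under both sections at every `e ∈ F`;
  if every `B` in the class other than `∅` and `univ` has a good pivot `e ∈ F` (the two inequalities `X̃_B(e) ≥ 0`, `Ψ_B(e) ≥ 0` of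
  `osN_threshold_goodPivot_step`), then `0 ≤ n_{N_F ≥ t}(A, B)` for every level `t`, EVERY increasing `A` and every increasing `B` with `𝒞 F B`;
* `goodPivot_of_section_sdiff_empty` — a coordinate `e` with `{ω | ω \ {e} ∈ B} = ∅` (an AND-literal of `B`) is always a good pivot;
* `osN_ind_ind_empty_right` — the escape case `B = ∅` (`B = univ` is `osN_ind_ind_univ_snd` of `…LiteralStep`);
* `osN_threshold_nonneg_of_goodPivots_on_pairs` (gen 38) — the SYMMETRIC form: both partners range over the section-closed class and at
  each node the pivot may be good for EITHER partner (`n` is symmetric, `osN_comm`); this is the form needed at codimension 3, where both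
  partners can be replaced by their hulls.
-/

noncomputable section

namespace Summit.CriticalPhenomena.PercolationContinuityZ3.Theorems

namespace SahiOneStep

open MeasureTheory Finset
open Literature.Probability.LatticeModels (prodBernoulli)
open Literature.Probability.Percolation.DecisionTree (ind)
open scoped Classical

variable {ι : Type*} [Fintype ι]

/-! ## Escape cases -/

/-- `n(H; 1_A, 1_∅) = 0`. [this work] -/
theorem osN_ind_ind_empty_right (p : ι → unitInterval) (H A : Set (Set ι)) :
    osN p H (ind A) (ind (∅ : Set (Set ι))) = 0 := by
  rw [osN_ind_ind, Set.inter_empty, Set.inter_empty, measureReal_empty]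
  ring

/-! ## AND-literal coordinates are good pivots -/

/-- If the lower section of `B` at `e` is empty (`x_e` is an AND-literal of `B`), then `e` is a GOOD pivot for `B` at `(F, t)`:
both inequalities `X̃_B(e) ≥ 0` and `Ψ_B(e) ≥ 0` of `osN_threshold_goodPivot_step` hold (the second by Harris for the increasing
upper section against the ball). [this work] -/
theorem goodPivot_of_section_sdiff_empty (p : ι → unitInterval) (F : Finset ι) (e : ι) (t : ℕ) {B : Set (Set ι)}
    (hB : IsUpperSet B) (h0 : {ω : Set ι | ω \ {e} ∈ B} = ∅) :
    (prodBernoulli p).real {ω : Set ι | (F.filter (· ∈ ω)).card < t} *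
        (prodBernoulli p).real ({ω : Set ι | ω \ {e} ∈ B} ∩ {ω : Set ι | (F.filter (· ∈ ω)).card < t + 1}) ≤
      (prodBernoulli p).real {ω : Set ι | (F.filter (· ∈ ω)).card < t + 1} *
        (prodBernoulli p).real ({ω : Set ι | insert e ω ∈ B} ∩ {ω : Set ι | (F.filter (· ∈ ω)).card < t}) ∧
    (prodBernoulli p).real {ω : Set ι | (F.filter (· ∈ ω)).card < t} * (1 - (prodBernoulli p).real {ω : Set ι | insert e ω ∈ B}) *
        ((prodBernoulli p).real {ω : Set ι | (F.filter (· ∈ ω)).card < t + 1} * (prodBernoulli p).real {ω : Set ι | ω \ {e} ∈ B}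
          - (prodBernoulli p).real ({ω : Set ι | ω \ {e} ∈ B} ∩ {ω : Set ι | (F.filter (· ∈ ω)).card < t + 1})) ≤
      (prodBernoulli p).real {ω : Set ι | (F.filter (· ∈ ω)).card < t + 1} * (1 - (prodBernoulli p).real {ω : Set ι | ω \ {e} ∈ B}) *
        ((prodBernoulli p).real {ω : Set ι | (F.filter (· ∈ ω)).card < t} * (prodBernoulli p).real {ω : Set ι | insert e ω ∈ B}
          - (prodBernoulli p).real ({ω : Set ι | insert e ω ∈ B} ∩ {ω : Set ι | (F.filter (· ∈ ω)).card < t})) := by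
  set μ := prodBernoulli p with hμ
  have hB1u : IsUpperSet {ω : Set ι | insert e ω ∈ B} := isUpperSet_section_insert hB e
  have hγ1 : μ.real ({ω : Set ι | insert e ω ∈ B} ∩ {ω : Set ι | (F.filter (· ∈ ω)).card < t}) ≤
      μ.real {ω : Set ι | insert e ω ∈ B} * μ.real {ω : Set ι | (F.filter (· ∈ ω)).card < t} :=
    real_inter_ball_le_mul p F hB1u t
  rw [h0, Set.empty_inter, measureReal_empty]
  constructor
  · rw [mul_zero]
    exact mul_nonneg measureReal_nonneg measureReal_nonneg
  · rw [mul_zero, sub_zero, mul_zero, sub_zero, mul_one]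
    refine mul_nonneg measureReal_nonneg ?_
    rw [mul_comm] at hγ1
    linarith

/-! ## `(2′)` on a section-closed class from good pivots inside the class -/

/-- **REDUCTION OF `(2′)` ON A SECTION-CLOSED CLASS TO GOOD PIVOTS INSIDE THE CLASS.**  Let `𝒞 F B` be a predicate on blocks and events
which is closed under both sections at every coordinate of the block.  Suppose every `B` with `𝒞 F B`, `F` nonempty, `B` increasing,
`B ≠ ∅`, `B ≠ univ`, admits a pivot `e ∈ F` that is GOOD for `B` at `(F ∖ e, t)` (`X̃_B(e) ≥ 0` and `Ψ_B(e) ≥ 0`).  Then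
`n_{N_F ≥ t}(A, B) ≥ 0` — `Cov(A,B) ≥ μ(N_F < t)·Cov(A,B ∣ N_F < t)` — for every block `F`, level `t`, EVERY increasing `A ⊆ 2^ι` and
every increasing `B` with `𝒞 F B`. [this work] -/
theorem osN_threshold_nonneg_of_goodPivots_on (p : ι → unitInterval) (𝒞 : Finset ι → Set (Set ι) → Prop)
    (hsec1 : ∀ (F : Finset ι) (B : Set (Set ι)) (e : ι), e ∈ F → 𝒞 F B → 𝒞 (F.erase e) {ω : Set ι | insert e ω ∈ B})
    (hsec0 : ∀ (F : Finset ι) (B : Set (Set ι)) (e : ι), e ∈ F → 𝒞 F B → 𝒞 (F.erase e) {ω : Set ι | ω \ {e} ∈ B})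
    (hgood : ∀ (F : Finset ι) (t : ℕ) (B : Set (Set ι)), F.Nonempty → IsUpperSet B → 𝒞 F B → B.Nonempty → B ≠ Set.univ →
      ∃ e ∈ F,
      (prodBernoulli p).real {ω : Set ι | ((F.erase e).filter (· ∈ ω)).card < t} *
          (prodBernoulli p).real ({ω : Set ι | ω \ {e} ∈ B} ∩ {ω : Set ι | ((F.erase e).filter (· ∈ ω)).card < t + 1}) ≤
        (prodBernoulli p).real {ω : Set ι | ((F.erase e).filter (· ∈ ω)).card < t + 1} *
          (prodBernoulli p).real ({ω : Set ι | insert e ω ∈ B} ∩ {ω : Set ι | ((F.erase e).filter (· ∈ ω)).card < t}) ∧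
      (prodBernoulli p).real {ω : Set ι | ((F.erase e).filter (· ∈ ω)).card < t} *
          (1 - (prodBernoulli p).real {ω : Set ι | insert e ω ∈ B}) *
          ((prodBernoulli p).real {ω : Set ι | ((F.erase e).filter (· ∈ ω)).card < t + 1} *
              (prodBernoulli p).real {ω : Set ι | ω \ {e} ∈ B}
            - (prodBernoulli p).real ({ω : Set ι | ω \ {e} ∈ B} ∩ {ω : Set ι | ((F.erase e).filter (· ∈ ω)).card < t + 1})) ≤
        (prodBernoulli p).real {ω : Set ι | ((F.erase e).filter (· ∈ ω)).card < t + 1} *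
          (1 - (prodBernoulli p).real {ω : Set ι | ω \ {e} ∈ B}) *
          ((prodBernoulli p).real {ω : Set ι | ((F.erase e).filter (· ∈ ω)).card < t} *
              (prodBernoulli p).real {ω : Set ι | insert e ω ∈ B}
            - (prodBernoulli p).real ({ω : Set ι | insert e ω ∈ B} ∩ {ω : Set ι | ((F.erase e).filter (· ∈ ω)).card < t})))
    (F : Finset ι) (t : ℕ) {A B : Set (Set ι)} (hA : IsUpperSet A) (hB : IsUpperSet B) (hBC : 𝒞 F B) :
    0 ≤ osN p {ω : Set ι | t ≤ (F.filter (· ∈ ω)).card} (ind A) (ind B) := by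
  induction hn : F.card using Nat.strong_induction_on generalizing F t A B with
  | _ n ih =>
  cases t with
  | zero => rw [threshold_zero, osN_ind_ind_univ]
  | succ t =>
    rcases F.eq_empty_or_nonempty with hF | hF
    · subst hF; rw [threshold_empty_succ, osN_ind_ind_empty]
    · rcases B.eq_empty_or_nonempty with hBe | hBne
      · subst hBe; rw [osN_ind_ind_empty_right]
      · by_cases hBu : B = Set.univ
        · subst hBu; rw [osN_ind_ind_univ_snd]
        · obtain ⟨e, heF, hX, hΨ⟩ := hgood F t B hF hB hBC hBne hBu
          have hF' : F = insert e (F.erase e) := (Finset.insert_erase heF).symm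
          have hcard : (F.erase e).card < n := by rw [← hn]; exact Finset.card_erase_lt_of_mem heF
          have hC1 : 𝒞 (F.erase e) {ω : Set ι | insert e ω ∈ B} := hsec1 F B e heF hBC
          have hC0 : 𝒞 (F.erase e) {ω : Set ι | ω \ {e} ∈ B} := hsec0 F B e heF hBC
          rw [hF']
          refine osN_threshold_goodPivot_step p (F.notMem_erase e) t hA hB ?_ ?_ ?_ hX hΨ
          · exact ih _ hcard (F.erase e) t (isUpperSet_section_insert hA e) (isUpperSet_section_insert hB e) hC1 rfl
          · exact ih _ hcard (F.erase e) (t + 1) (isUpperSet_section_insert hA e) (isUpperSet_section_sdiff hB e) hC0 rfl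
          · exact ih _ hcard (F.erase e) (t + 1) (isUpperSet_section_sdiff hA e) (isUpperSet_section_sdiff hB e) hC0 rfl

/-! ## Symmetric form: the pivot may be good for either partner -/

/-- **REDUCTION OF `(2′)` ON A SECTION-CLOSED CLASS OF PAIRS TO GOOD PIVOTS FOR EITHER PARTNER.**  Let `𝒞 F B` be closed under both
sections at every coordinate of the block.  Suppose that for every block `F ≠ ∅`, level `t` and every two increasing events `A, B` of the
class, both different from `∅` and `univ`, some `e ∈ F` is a GOOD pivot at `(F ∖ e, t)` for `B` OR for `A` (the two inequalities `X̃ ≥ 0`,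
`Ψ ≥ 0` of `osN_threshold_goodPivot_step` for that event).  Then `n_{N_F ≥ t}(A, B) ≥ 0` for every `F`, `t` and all increasing `A, B` in
the class.  (Symmetry `osN_comm` lets the step constrain either partner; all section pairs stay in the class.) [this work] -/
theorem osN_threshold_nonneg_of_goodPivots_on_pairs (p : ι → unitInterval) (𝒞 : Finset ι → Set (Set ι) → Prop)
    (hsec1 : ∀ (F : Finset ι) (B : Set (Set ι)) (e : ι), e ∈ F → 𝒞 F B → 𝒞 (F.erase e) {ω : Set ι | insert e ω ∈ B})
    (hsec0 : ∀ (F : Finset ι) (B : Set (Set ι)) (e : ι), e ∈ F → 𝒞 F B → 𝒞 (F.erase e) {ω : Set ι | ω \ {e} ∈ B})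
    (hgood : ∀ (F : Finset ι) (t : ℕ) (A B : Set (Set ι)), F.Nonempty → IsUpperSet A → IsUpperSet B → 𝒞 F A → 𝒞 F B →
      A.Nonempty → A ≠ Set.univ → B.Nonempty → B ≠ Set.univ →
      ∃ e ∈ F,
        ((prodBernoulli p).real {ω : Set ι | ((F.erase e).filter (· ∈ ω)).card < t} *
            (prodBernoulli p).real ({ω : Set ι | ω \ {e} ∈ B} ∩ {ω : Set ι | ((F.erase e).filter (· ∈ ω)).card < t + 1}) ≤
          (prodBernoulli p).real {ω : Set ι | ((F.erase e).filter (· ∈ ω)).card < t + 1} *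
            (prodBernoulli p).real ({ω : Set ι | insert e ω ∈ B} ∩ {ω : Set ι | ((F.erase e).filter (· ∈ ω)).card < t}) ∧
        (prodBernoulli p).real {ω : Set ι | ((F.erase e).filter (· ∈ ω)).card < t} *
            (1 - (prodBernoulli p).real {ω : Set ι | insert e ω ∈ B}) *
            ((prodBernoulli p).real {ω : Set ι | ((F.erase e).filter (· ∈ ω)).card < t + 1} *
                (prodBernoulli p).real {ω : Set ι | ω \ {e} ∈ B}
              - (prodBernoulli p).real ({ω : Set ι | ω \ {e} ∈ B} ∩ {ω : Set ι | ((F.erase e).filter (· ∈ ω)).card < t + 1})) ≤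
          (prodBernoulli p).real {ω : Set ι | ((F.erase e).filter (· ∈ ω)).card < t + 1} *
            (1 - (prodBernoulli p).real {ω : Set ι | ω \ {e} ∈ B}) *
            ((prodBernoulli p).real {ω : Set ι | ((F.erase e).filter (· ∈ ω)).card < t} *
                (prodBernoulli p).real {ω : Set ι | insert e ω ∈ B}
              - (prodBernoulli p).real ({ω : Set ι | insert e ω ∈ B} ∩ {ω : Set ι | ((F.erase e).filter (· ∈ ω)).card < t})))
        ∨ ((prodBernoulli p).real {ω : Set ι | ((F.erase e).filter (· ∈ ω)).card < t} *
            (prodBernoulli p).real ({ω : Set ι | ω \ {e} ∈ A} ∩ {ω : Set ι | ((F.erase e).filter (· ∈ ω)).card < t + 1}) ≤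
          (prodBernoulli p).real {ω : Set ι | ((F.erase e).filter (· ∈ ω)).card < t + 1} *
            (prodBernoulli p).real ({ω : Set ι | insert e ω ∈ A} ∩ {ω : Set ι | ((F.erase e).filter (· ∈ ω)).card < t}) ∧
        (prodBernoulli p).real {ω : Set ι | ((F.erase e).filter (· ∈ ω)).card < t} *
            (1 - (prodBernoulli p).real {ω : Set ι | insert e ω ∈ A}) *
            ((prodBernoulli p).real {ω : Set ι | ((F.erase e).filter (· ∈ ω)).card < t + 1} *
                (prodBernoulli p).real {ω : Set ι | ω \ {e} ∈ A}
              - (prodBernoulli p).real ({ω : Set ι | ω \ {e} ∈ A} ∩ {ω : Set ι | ((F.erase e).filter (· ∈ ω)).card < t + 1})) ≤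
          (prodBernoulli p).real {ω : Set ι | ((F.erase e).filter (· ∈ ω)).card < t + 1} *
            (1 - (prodBernoulli p).real {ω : Set ι | ω \ {e} ∈ A}) *
            ((prodBernoulli p).real {ω : Set ι | ((F.erase e).filter (· ∈ ω)).card < t} *
                (prodBernoulli p).real {ω : Set ι | insert e ω ∈ A}
              - (prodBernoulli p).real ({ω : Set ι | insert e ω ∈ A} ∩ {ω : Set ι | ((F.erase e).filter (· ∈ ω)).card < t}))))
    (F : Finset ι) (t : ℕ) {A B : Set (Set ι)} (hA : IsUpperSet A) (hB : IsUpperSet B) (hAC : 𝒞 F A) (hBC : 𝒞 F B) :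
    0 ≤ osN p {ω : Set ι | t ≤ (F.filter (· ∈ ω)).card} (ind A) (ind B) := by
  induction hn : F.card using Nat.strong_induction_on generalizing F t A B with
  | _ n ih =>
  cases t with
  | zero => rw [threshold_zero, osN_ind_ind_univ]
  | succ t =>
    rcases F.eq_empty_or_nonempty with hF | hF
    · subst hF; rw [threshold_empty_succ, osN_ind_ind_empty]
    · rcases B.eq_empty_or_nonempty with hBe | hBne
      · subst hBe; rw [osN_ind_ind_empty_right]
      · by_cases hBu : B = Set.univ
        · subst hBu; rw [osN_ind_ind_univ_snd]
        · rcases A.eq_empty_or_nonempty with hAe | hAne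
          · subst hAe; rw [osN_comm, osN_ind_ind_empty_right]
          · by_cases hAu : A = Set.univ
            · subst hAu; rw [osN_comm, osN_ind_ind_univ_snd]
            · obtain ⟨e, heF, hgoodBA⟩ := hgood F t A B hF hA hB hAC hBC hAne hAu hBne hBu
              have hF' : F = insert e (F.erase e) := (Finset.insert_erase heF).symm
              have hcard : (F.erase e).card < n := by rw [← hn]; exact Finset.card_erase_lt_of_mem heF
              have hA1 : 𝒞 (F.erase e) {ω : Set ι | insert e ω ∈ A} := hsec1 F A e heF hAC
              have hA0 : 𝒞 (F.erase e) {ω : Set ι | ω \ {e} ∈ A} := hsec0 F A e heF hAC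
              have hB1 : 𝒞 (F.erase e) {ω : Set ι | insert e ω ∈ B} := hsec1 F B e heF hBC
              have hB0 : 𝒞 (F.erase e) {ω : Set ι | ω \ {e} ∈ B} := hsec0 F B e heF hBC
              rw [hF']
              rcases hgoodBA with ⟨hX, hΨ⟩ | ⟨hX, hΨ⟩
              · refine osN_threshold_goodPivot_step p (F.notMem_erase e) t hA hB ?_ ?_ ?_ hX hΨ
                · exact ih _ hcard (F.erase e) t (isUpperSet_section_insert hA e) (isUpperSet_section_insert hB e) hA1 hB1 rfl
                · exact ih _ hcard (F.erase e) (t + 1) (isUpperSet_section_insert hA e) (isUpperSet_section_sdiff hB e) hA1 hB0 rfl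
                · exact ih _ hcard (F.erase e) (t + 1) (isUpperSet_section_sdiff hA e) (isUpperSet_section_sdiff hB e) hA0 hB0 rfl
              · rw [osN_comm]
                refine osN_threshold_goodPivot_step p (F.notMem_erase e) t hB hA ?_ ?_ ?_ hX hΨ
                · exact ih _ hcard (F.erase e) t (isUpperSet_section_insert hB e) (isUpperSet_section_insert hA e) hB1 hA1 rfl
                · exact ih _ hcard (F.erase e) (t + 1) (isUpperSet_section_insert hB e) (isUpperSet_section_sdiff hA e) hB1 hA0 rfl
                · exact ih _ hcard (F.erase e) (t + 1) (isUpperSet_section_sdiff hB e) (isUpperSet_section_sdiff hA e) hB0 hA0 rfl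

end SahiOneStep

end Summit.CriticalPhenomena.PercolationContinuityZ3.Theorems
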